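import Mathlib
import Summits.Ventures.HodgeRepro2.B3Hilbert90
import Summits.Ventures.HodgeRepro2.T5TameRamifiedNormGroup
import Summits.Ventures.HodgeRepro2.T5QuadraticGalois

/-!
# The norm-one group at a tamely ramified place: `E¹_v = {±1} · j(O_{E_v}^×)`, `−1 ∉ j(O_{E_v}^×)`

Hilbert 90 (`B3Hilbert90`, p2) writes every norm-one `z ∈ Lw` as `e / σ e`; with the anti-invariant
uniformiser `θ` of `T5TameRamifiedNormGroup` (`σ θ = −θ`, `v θ = exp (−1)`), `e = u θ^m` with `u`
a unit gives `z = (−1)^m · u / σ u` (`exists_units_div_conj_eq_or_neg`), and `−1` itself is not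
`u / σ u` for a unit `u` — an anti-invariant unit is impossible (`neg_one_notMem_range_div_conj`).
So `j : O_{E_v}^× → E¹_v`, `u ↦ u / σ u`, has image of INDEX 2 at a tamely ramified place, in
contrast to the inert case where it is onto (route/T5-route-2.md (A5): «at inert `v` already
`U_E → E¹_v` is onto»; `T5LocalUnitHilbert90`, row 112).

Declaration per README §8(d): «uses an L-value-free non-vanishing device: NO».
-/

namespace Summit.Ventures.HodgeRepro2.T5TameRamifiedNormOne

open IsDedekindDomain HeightOneSpectrum WithZero

variable {K : Type*} [Field K] [NumberField K] (v : HeightOneSpectrum (NumberField.RingOfIntegers K))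
  {L : Type*} [Field L] [NumberField L] [Algebra K L]
  (w : HeightOneSpectrum (NumberField.RingOfIntegers L)) [w.asIdeal.LiesOver v.asIdeal]
  (σ : Gal(adicCompletion L w/adicCompletion K v))
  (h2 : Module.finrank (adicCompletion K v) (adicCompletion L w) = 2)
  {ϖ : adicCompletionIntegers K v} (hϖ : Irreducible ϖ)
  {π : adicCompletionIntegers L w} (hπ : Irreducible π)
  (hram : ¬ Irreducible (algebraMap (adicCompletionIntegers K v) (adicCompletionIntegers L w) ϖ))
  (hσ : σ ≠ 1) (h2u : IsUnit (2 : adicCompletionIntegers K v))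

include hσ in
/-- `σ` has a non-fixed point. -/
theorem exists_algEquiv_ne : ∃ a : adicCompletion L w, σ a ≠ a := by
  by_contra h
  simp only [not_exists, not_not] at h
  exact hσ (AlgEquiv.ext h)

include h2 in
/-- `σ ∘ σ = id` (`Gal(Lw/Kv)` has order 2). -/
theorem algEquiv_algEquiv (x : adicCompletion L w) : σ (σ x) = x := by
  haveI : FiniteDimensional (adicCompletion K v) (adicCompletion L w) := FiniteDimensional.of_finrank_eq_succ h2
  have h : σ ^ 2 = 1 := by
    rw [← T5QuadraticGalois.card_aut_eq_two h2]
    exact pow_card_eq_one'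
  have hσσ : σ * σ = 1 := by rwa [sq] at h
  rw [← AlgEquiv.mul_apply, hσσ, AlgEquiv.one_apply]

include h2 hϖ hπ hram hσ h2u in
/-- HILBERT 90 WITH UNITS at a tamely ramified place: every norm-one `z` is `u / σ u` or
`−(u / σ u)` for a UNIT `u` of `O_Lw`. -/
theorem exists_units_div_conj_eq_or_neg {z : adicCompletion L w} (hz : z * σ z = 1) :
    ∃ u : (adicCompletionIntegers L w)ˣ,
      z = ((u : adicCompletionIntegers L w) : adicCompletion L w) / σ ((u : adicCompletionIntegers L w) : adicCompletion L w) ∨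
      z = -(((u : adicCompletionIntegers L w) : adicCompletion L w) / σ ((u : adicCompletionIntegers L w) : adicCompletion L w)) := by
  obtain ⟨e, he0, hez⟩ := ShimuraData.B3Hilbert90.exists_div_conj_of_mul_conj_eq_one (σ : adicCompletion L w ≃+* adicCompletion L w)
    (algEquiv_algEquiv v w σ h2) (exists_algEquiv_ne v w σ hσ) hz
  simp only [AlgEquiv.coe_ringEquiv] at hez
  obtain ⟨θ, hθ, hθv⟩ := T5TameRamifiedNormGroup.exists_anti_val_eq_exp_neg_one v w σ h2 hϖ hπ hram hσ h2u
  obtain ⟨u, hu1, hu⟩ := T5UnramifiedCharacter.exists_val_eq_one_mul_zpow hθv he0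
  set m : ℤ := -(Valued.v e).log with hm
  have hθ0 : θ ≠ 0 := by
    intro h; rw [h, map_zero] at hθv; exact exp_ne_zero hθv.symm
  have hu0 : u ≠ 0 := by
    intro h; rw [h, map_zero] at hu1; exact zero_ne_one hu1
  have humem : u ∈ adicCompletionIntegers L w := (mem_adicCompletionIntegers _ _ _).mpr hu1.le
  have huunit : IsUnit (⟨u, humem⟩ : adicCompletionIntegers L w) := by
    rw [← IsLocalRing.notMem_maximalIdeal, T5AdicCompletionResidueField.mem_maximalIdeal_iff]
    simp [hu1]
  refine ⟨huunit.unit, ?_⟩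
  have hcoe : ((huunit.unit : adicCompletionIntegers L w) : adicCompletion L w) = u := by
    rw [IsUnit.unit_spec]
  rw [hcoe]
  -- `z = e / σ e = (u θ^m) / (σ u (−θ)^m) = ± u / σ u`
  have hz' : z = u * θ ^ m / (σ u * (-θ) ^ m) := by
    rw [hez, hu, map_mul, map_zpow₀, hθ]
  have hθm : θ ^ m ≠ 0 := zpow_ne_zero _ hθ0
  rcases Int.even_or_odd m with hm | hm
  · left
    rw [hz', hm.neg_zpow, mul_div_mul_right _ _ hθm]
  · right
    rw [hz', hm.neg_zpow, mul_neg, div_neg, mul_div_mul_right _ _ hθm]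

include h2 hϖ hπ hram h2u in
/-- `−1` IS NOT `u / σ u` FOR A UNIT `u` at a tamely ramified place (an anti-invariant unit is
impossible): the image of `j : O_{E_v}^× → E¹_v` has index 2. -/
theorem neg_one_notMem_range_div_conj :
    ¬ ∃ u : (adicCompletionIntegers L w)ˣ,
      ((u : adicCompletionIntegers L w) : adicCompletion L w) / σ ((u : adicCompletionIntegers L w) : adicCompletion L w) = -1 := by
  rintro ⟨u, hu⟩
  have hu1 : Valued.v ((u : adicCompletionIntegers L w) : adicCompletion L w) = 1 :=
    T5AdicCompletionNormSurjective.val_coe_units_eq_one w u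
  have hσu0 : σ ((u : adicCompletionIntegers L w) : adicCompletion L w) ≠ 0 := by
    rw [map_ne_zero]
    intro h; rw [h, map_zero] at hu1; exact zero_ne_one hu1
  have hanti : σ ((u : adicCompletionIntegers L w) : adicCompletion L w) =
      -((u : adicCompletionIntegers L w) : adicCompletion L w) := by
    rw [div_eq_iff hσu0] at hu
    have := congrArg σ hu
    rw [map_mul, map_neg, map_one, algEquiv_algEquiv v w σ h2] at this
    rw [this]; ring
  exact T5TameRamifiedNormGroup.not_anti_of_val_eq_one v w σ h2 hϖ hπ hram h2u hanti hu1

end Summit.Ventures.HodgeRepro2.T5TameRamifiedNormOne
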